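import Summits.ValiantsHypothesis.ValiantsHypothesis.Theorems.EquivariantDialLayersApolarOrbits
import HarnessLib

/-!
# Orbit-sum vanishing for products of rank-one block forms (support for `EquivariantDialLayers`, `d ≥ 3`)

Support statements only (lane `--supports`); nothing here closes a route item; the leaf `IdealWidthSuperpoly` is
untouched. File R2b of the «block-witness apolar bound» programme: the `MvPolynomial` dress of the scalar identity
`EquivariantDialLayersApolarOrbits.sum_perm_prod_sumCongr_eq_zero`. The rank-one forms are written inline,
`ℓ(v, w) = ∑_p C (v p.1 * w p.2) * X p` on the `m × m` variable matrix `X : Fin m × Fin m`.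
* §1 Moves and expansion: `rename (σ × τ) (∑_p C (c p) X_p) = ∑_p C (c (σ⁻¹ p.1, τ⁻¹ p.2)) X_p`, its two-layer
  version for products, and the multilinear expansion `∏_i ∑_p C (A_i p · B_i p) X_p = ∑_P C (∏_i A_i (P i)) ·
  ∏_i C (B_i (P i)) X_{P i}` (`Fintype.prod_sum`), in both orders.
* §2 ★ ROW ORBIT VANISHING `sum_rename_prod_linForm_eq_zero_of_row`: for row vectors `v_i` that are pairwise equal
  or disjointly supported, power-sum free up to `D ≥ #ι`, with `a + 1` of them pairwise distinct, ANY column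
  vectors `w_i` and ANY `g ∈ 𝔖_m × 𝔖_m`, the Young-subgroup orbit sum `∑_{ρ' ∈ 𝔖_b} ((e(1 ⊕ ρ')) × 1) · g ·
  ∏_i ℓ(v_i, w_i)` vanishes (`e : Fin a ⊕ Fin b ≃ Fin m`) — literally the hypothesis `hu` of
  `EquivariantDialLayersApolarKill.boxProd_isotypicProj_eq_zero_of_row` for `u = ∏_i ℓ(v_i, w_i)` in the
  coordinate ring; ★ COLUMN twin `…_of_col` with the roles of `v` and `w` exchanged. Proof: move the
  `g₁`-translate into the family (`v_i ↦ v_i ∘ g₁⁻¹` keeps every hypothesis — this is why they are invariant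
  ones), expand multilinearly, and the coefficient of each monomial pattern `P` is `C` of the scalar orbit sum of
  `EquivariantDialLayersApolarOrbits`, which is `0`.
-/

set_option linter.dupNamespace false

namespace Summit.ValiantsHypothesis.ValiantsHypothesis.Theorems.EquivariantDialLayersApolarForms

open MvPolynomial
open Equiv (Perm)
open Summit.ValiantsHypothesis.ValiantsHypothesis.Theorems.EquivariantDialLayersApolarOrbits

variable {m : ℕ}

/-! ## §1 Moves of rank-one forms and the multilinear expansion -/

/-- `(σ × τ) · ∑_p C (c p) X_p = ∑_p C (c (σ⁻¹ p₁, τ⁻¹ p₂)) X_p`. [folklore] -/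
theorem rename_prodCongr_sum_C_mul_X (σ τ : Perm (Fin m)) (c : Fin m × Fin m → ℂ) :
    rename (Equiv.prodCongr σ τ) (∑ p : Fin m × Fin m, C (c p) * X p) =
      ∑ p : Fin m × Fin m, C (c (σ⁻¹ p.1, τ⁻¹ p.2)) * X p := by
  simp only [map_sum, map_mul, rename_C, rename_X]
  exact Fintype.sum_equiv (Equiv.prodCongr σ τ) _ _ fun p => by simp

/-- Two layers of moves through a product of forms. [folklore] -/
theorem rename_rename_prod_sum_C_mul_X {ι : Type*} [Fintype ι] (π₁ π₂ σ τ : Perm (Fin m))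
    (c : ι → Fin m × Fin m → ℂ) :
    rename (Equiv.prodCongr π₁ π₂) (rename (Equiv.prodCongr σ τ) (∏ i, ∑ p : Fin m × Fin m, C (c i p) * X p)) =
      ∏ i, ∑ p : Fin m × Fin m, C (c i (σ⁻¹ (π₁⁻¹ p.1), τ⁻¹ (π₂⁻¹ p.2))) * X p := by
  simp only [map_prod, rename_prodCongr_sum_C_mul_X]

/-- Multilinear expansion, the first factor of each coefficient collected under one `C`. [folklore] -/
theorem prod_sum_C_mul_X_eq_sum {ι : Type*} [Fintype ι] [DecidableEq ι] (A B : ι → Fin m × Fin m → ℂ) :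
    ∏ i, ∑ p : Fin m × Fin m, C (A i p * B i p) * X p =
      ∑ P : ι → Fin m × Fin m, C (∏ i, A i (P i)) * ∏ i, (C (B i (P i)) * X (P i)) := by
  rw [Fintype.prod_sum]
  refine Finset.sum_congr rfl fun P _ => ?_
  rw [map_prod, ← Finset.prod_mul_distrib]
  exact Finset.prod_congr rfl fun i _ => by rw [map_mul, mul_assoc]

/-- The same with the second factor collected. [folklore] -/
theorem prod_sum_C_mul_X_eq_sum' {ι : Type*} [Fintype ι] [DecidableEq ι] (A B : ι → Fin m × Fin m → ℂ) :
    ∏ i, ∑ p : Fin m × Fin m, C (A i p * B i p) * X p =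
      ∑ P : ι → Fin m × Fin m, C (∏ i, B i (P i)) * ∏ i, (C (A i (P i)) * X (P i)) := by
  have h : ∀ i p, A i p * B i p = B i p * A i p := fun _ _ => mul_comm _ _
  simp_rw [h]
  exact prod_sum_C_mul_X_eq_sum B A

/-! ## §2 Orbit-sum vanishing over the Young subgroup, in the coordinate ring -/

/-- The scalar orbit sum of `EquivariantDialLayersApolarOrbits` for the translated family `v_i ∘ σ⁻¹` (all its
hypotheses are invariant under the translation). [folklore] -/
theorem sum_perm_prod_sumCongr_comp_eq_zero {ι : Type*} [Fintype ι] {a b D : ℕ} (e : Fin a ⊕ Fin b ≃ Fin m)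
    (v : ι → Fin m → ℂ) (hH1 : ∀ i j, v i = v j ∨ ∀ x, v i x = 0 ∨ v j x = 0)
    (hH2 : ∀ i (k : ℕ), 1 ≤ k → k ≤ D → ∑ x, v i x ^ k = 0) (hD : Fintype.card ι ≤ D)
    (rep : Fin (a + 1) → ι) (hrep : Function.Injective fun j => v (rep j)) (σ : Perm (Fin m)) (pt : ι → Fin m) :
    ∑ ρ' : Perm (Fin b), ∏ i, v i (σ⁻¹ ((e.permCongr ((1 : Perm (Fin a)).sumCongr ρ'))⁻¹ (pt i))) = 0 := by
  have hH1' : ∀ i j, (fun x => v i (σ⁻¹ x)) = (fun x => v j (σ⁻¹ x)) ∨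
      ∀ x, v i (σ⁻¹ x) = 0 ∨ v j (σ⁻¹ x) = 0 :=
    fun i j => (hH1 i j).imp (fun h => by rw [h]) fun h x => h _
  have hH2' : ∀ i (k : ℕ), 1 ≤ k → k ≤ D → ∑ x, v i (σ⁻¹ x) ^ k = 0 := fun i k hk hkD =>
    (Equiv.sum_comp σ⁻¹ fun x => v i x ^ k).trans (hH2 i k hk hkD)
  have hrep' : Function.Injective fun j => fun x => v (rep j) (σ⁻¹ x) := fun j j' h =>
    hrep (funext fun x => by simpa using congrFun h (σ x))
  exact sum_perm_prod_sumCongr_eq_zero e (fun i x => v i (σ⁻¹ x)) hH1' hH2' hD rep hrep' pt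

/-- ★ ROW ORBIT VANISHING: `∑_{ρ' ∈ 𝔖_b} ((e(1 ⊕ ρ')) × 1) · g · ∏_i ℓ(v_i, w_i) = 0` for row vectors `v_i` with
the INVARIANT hypotheses (`hH1` pairwise equal or disjointly supported, `hH2` power-sum free up to `D ≥ #ι`, `rep`
`a + 1` pairwise distinct), any column vectors `w_i`, any `g ∈ 𝔖_m × 𝔖_m`. [folklore] -/
theorem sum_rename_prod_linForm_eq_zero_of_row {ι : Type*} [Fintype ι] {a b D : ℕ} (e : Fin a ⊕ Fin b ≃ Fin m)
    (v : ι → Fin m → ℂ) (hH1 : ∀ i j, v i = v j ∨ ∀ x, v i x = 0 ∨ v j x = 0)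
    (hH2 : ∀ i (k : ℕ), 1 ≤ k → k ≤ D → ∑ x, v i x ^ k = 0) (hD : Fintype.card ι ≤ D)
    (rep : Fin (a + 1) → ι) (hrep : Function.Injective fun j => v (rep j)) (w : ι → Fin m → ℂ)
    (g : Perm (Fin m) × Perm (Fin m)) :
    ∑ ρ' : Perm (Fin b), rename (Equiv.prodCongr (e.permCongr ((1 : Perm (Fin a)).sumCongr ρ')) (1 : Perm (Fin m)))
      (rename (Equiv.prodCongr g.1 g.2) (∏ i, ∑ p : Fin m × Fin m, C (v i p.1 * w i p.2) * X p)) = 0 := by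
  classical
  simp_rw [rename_rename_prod_sum_C_mul_X, inv_one, Perm.one_apply, prod_sum_C_mul_X_eq_sum]
  rw [Finset.sum_comm]
  refine Finset.sum_eq_zero fun P _ => ?_
  rw [← Finset.sum_mul, ← map_sum, sum_perm_prod_sumCongr_comp_eq_zero e v hH1 hH2 hD rep hrep g.1 fun i => (P i).1,
    map_zero, zero_mul]

/-- ★ COLUMN ORBIT VANISHING: `∑_{ρ' ∈ 𝔖_b} (1 × (e(1 ⊕ ρ'))) · g · ∏_i ℓ(v_i, w_i) = 0` for column vectors `w_i`
with the invariant hypotheses, any row vectors `v_i`, any `g ∈ 𝔖_m × 𝔖_m`. [folklore] -/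
theorem sum_rename_prod_linForm_eq_zero_of_col {ι : Type*} [Fintype ι] {a b D : ℕ} (e : Fin a ⊕ Fin b ≃ Fin m)
    (w : ι → Fin m → ℂ) (hH1 : ∀ i j, w i = w j ∨ ∀ x, w i x = 0 ∨ w j x = 0)
    (hH2 : ∀ i (k : ℕ), 1 ≤ k → k ≤ D → ∑ x, w i x ^ k = 0) (hD : Fintype.card ι ≤ D)
    (rep : Fin (a + 1) → ι) (hrep : Function.Injective fun j => w (rep j)) (v : ι → Fin m → ℂ)
    (g : Perm (Fin m) × Perm (Fin m)) :
    ∑ ρ' : Perm (Fin b), rename (Equiv.prodCongr (1 : Perm (Fin m)) (e.permCongr ((1 : Perm (Fin a)).sumCongr ρ')))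
      (rename (Equiv.prodCongr g.1 g.2) (∏ i, ∑ p : Fin m × Fin m, C (v i p.1 * w i p.2) * X p)) = 0 := by
  classical
  simp_rw [rename_rename_prod_sum_C_mul_X, inv_one, Perm.one_apply, prod_sum_C_mul_X_eq_sum']
  rw [Finset.sum_comm]
  refine Finset.sum_eq_zero fun P _ => ?_
  rw [← Finset.sum_mul, ← map_sum, sum_perm_prod_sumCongr_comp_eq_zero e w hH1 hH2 hD rep hrep g.2 fun i => (P i).2,
    map_zero, zero_mul]

end Summit.ValiantsHypothesis.ValiantsHypothesis.Theorems.EquivariantDialLayersApolarForms
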